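import Literature.Barriers.CriticalPhenomena.RigorousRGSmallParameterSelfSimilarCovariance
import Literature.Barriers.CriticalPhenomena.RigorousRGSmallParameterCovarianceMassDerivative
import HarnessLib

/-!
# `RigorousRGSmallParameter` (Slade, Theorem 1.4.1): Lemma 10.3.2 — the dependence of the scaling
# function `c₀(x, A)` on the (rescaled) mass `A`

Fifth file of the §10.3 layer. G. Slade, *Critical exponents for long-range `O(n)` models below the
upper critical dimension*, Commun. Math. Phys. **358** (2018), §10.3: "The next lemma is used in the
proof of Lemma 5.2.3. **Lemma 10.3.2.** Let `d ≥ 1`, `α ∈ (0,2∧d)`. There exists `z > 0` such that for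
`x ∈ ℝ^d` and `0 < A < A'`, (10.42) `|c₀(x,A) - c₀(x,A')| ≲ 𝟙_{A≤1}(A')^z + 𝟙_{A'>1}A^{-2}`. *Proof.* By
(10.40) and the Fundamental Theorem of Calculus, `c₀(x,A) - c₀(x,A') = ∫_0^∞dσ∫_A^{A'}da
(∂ρ(σ,a)/∂a)∫_{½L^{-1}}^{½}(dτ/τ)(c/τ)^{d-2}w̄(cx/τ, στ²)`. By (10.9) and (10.39), with arbitrary `p ≥ 0`
and with `β = α/2`, `|c₀(x,A) - c₀(x,A')| ≲ ∫_A^{A'}da∫_0^∞dσ (σ^β/(σ^β+a)³)∫(dτ/τ)τ^{2-d}(1+στ²)^{-p}`.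
We decompose the `σ`-integral as `∫_0^∞ = ∫_0^1 + ∫_1^∞`. This leads to `… = ∫_A^{A'}da
(I₁(β,β,1,a) + I₂(β-p,β,1,a))`. By Lemma 10.1.4, the integrand on the right-hand side is bounded by a
multiple of `(𝟙_{a≤1}a^{-(2-1/β)} + 𝟙_{a≥1}a^{-3}) + (𝟙_{a≤1} + 𝟙_{a≥1}a^{-p'})`, with `p'` as large as
desired. The contribution from `I₁` is dominant for both large and small `a`, and it is bounded by
`𝟙_{A≤1}a^{-(2-1/β)} + 𝟙_{A'>1}a^{-3}`. Integration of this upper bound then gives the desired result,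
with `z = -1+1/β > 0`. □"

Here `c₀ = FRD.cZero d L α` of `RigorousRGSmallParameterSelfSimilarCovariance.lean`, and the inner
`τ`-integral is the kernel `G_L(y,σ) = FRD.cZeroKer` with `|G_L(y,σ)| ≤ K(1+σ/(8dL²))^{-2}`
(`FRD.abs_cZeroKer_le`, from (10.39)). The proof below evaluates the `a`-integral FIRST (so no
Fubini is needed): for each `σ > 0`, `|ρ(σ,A) - ρ(σ,B)| = |∫_A^B∂_aρ|` with (10.9)
`|∂_aρ(σ,a)| ≤ c_D σ^β/(σ^β+a)³` (`Kato.abs_katoDensityDeriv_le`), and `(σ^β+a)^{-3} ≤ a^{-ν}σ^{-β(3-ν)}`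
(weighted AM–GM) on `a ≤ 1`, resp. `≤ a^{-3}` on `a ≥ 1`; with `ν = (1+max(0,2-1/β))/2 ∈
[max(0,2-1/β), 1)` the `σ`-weights `σ^{β(ν-2)}`, `σ^β` are integrable against `|G_L|`, and the
`a`-integrals give `(A')^{1-ν}` and `A^{-2}`. This yields (10.42) with `z = 1-ν > 0` for every
`β = α/2 ∈ (0,1)` simultaneously (for `β > ½` one may take any `z < 1/β - 1`, Slade's exponent, by
letting `ν ↓ 2-1/β`; the logarithmic case `β = ½` needs no separate treatment).

## What this file proves (everything; no definition, no named fact)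

* `FRD.rpow_mul_rpow_le_add_pow_three` (`y^νx^{3-ν} ≤ (x+y)³`), `FRD.inv_add_pow_three_le`.
* `FRD.abs_katoDensity_sub_le_low` (`|ρ(σ,A)-ρ(σ,B)| ≤ (c_D/(1-ν))σ^{β(ν-2)}B^{1-ν}`),
  `FRD.abs_katoDensity_sub_le_high` (`≤ (c_D/2)σ^βA^{-2}`) — FTC in the mass and (10.9).
* `FRD.integral_majorant_rpow_le` (`∫_0^∞K(1+bσ)^{-2}σ^e ≤ K(1/(e+1)+b^{-2}/(1-e))`, `-1 < e < 1`),
  `FRD.abs_cZero_sub_le_of` (the `σ`-integration against `G_L`).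
* **`FRD.Slade2017_lem1032`** — **Lemma 10.3.2, PROVED**: for `d ≥ 1`, `α ∈ (0,2)`, `L ≥ 1` there are
  `z > 0` and `C` with `|c₀(y,A) - c₀(y,A')| ≤ C(𝟙_{A≤1}(A')^z + 𝟙_{A'>1}A^{-2})` for all `y` and all
  `0 < A < A'`.
-/

noncomputable section

namespace Literature.Barriers.CriticalPhenomena

open _root_.MeasureTheory Set Filter
open scoped _root_.Topology Real

namespace LongRangePhi4

namespace FRD

/-! ### An elementary inequality: `(x+y)³ ≥ y^ν x^{3-ν}` -/

/-- Weighted AM–GM consequence: `y^ν x^{3-ν} ≤ (x+y)³` for `x, y > 0`, `ν ∈ [0,3]`. [folklore] -/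
theorem rpow_mul_rpow_le_add_pow_three {x y ν : ℝ} (hx : 0 < x) (hy : 0 < y) (hν0 : 0 ≤ ν) (hν3 : ν ≤ 3) :
    y ^ ν * x ^ (3 - ν) ≤ (x + y) ^ 3 := by
  have hw := Real.geom_mean_le_arith_mean2_weighted (w₁ := (3 - ν) / 3) (w₂ := ν / 3)
    (p₁ := x) (p₂ := y) (by linarith) (by linarith) hx.le hy.le (by ring)
  have h1 : x ^ ((3 - ν) / 3) * y ^ (ν / 3) ≤ x + y := by
    refine hw.trans ?_
    nlinarith [mul_nonneg (by linarith : (0 : ℝ) ≤ ν / 3) hx.le,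
      mul_nonneg (by linarith : (0 : ℝ) ≤ (3 - ν) / 3) hy.le]
  have h0 : 0 ≤ x ^ ((3 - ν) / 3) * y ^ (ν / 3) := by positivity
  have h2 := pow_le_pow_left₀ h0 h1 3
  have e : (x ^ ((3 - ν) / 3) * y ^ (ν / 3)) ^ 3 = y ^ ν * x ^ (3 - ν) := by
    rw [mul_pow, ← Real.rpow_natCast (x ^ ((3 - ν) / 3)) 3, ← Real.rpow_natCast (y ^ (ν / 3)) 3,
      ← Real.rpow_mul hx.le, ← Real.rpow_mul hy.le]
    push_cast
    rw [show (3 - ν) / 3 * 3 = 3 - ν by ring, show ν / 3 * 3 = ν by ring, mul_comm]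
  rw [e] at h2
  exact h2

/-- `(s^β+a)^{-3} ≤ a^{-ν}s^{-β(3-ν)}` for `s, a > 0`, `ν ∈ [0,3]` ("`(σ^β+A)^{-2-q} ≤ A^{-2-q}`" is
`ν = 3`; `ν = 0` is `≤ s^{-3β}`). [cite: Slade2017, §10.1 (proof of Lemma 10.1.4)] -/
theorem inv_add_pow_three_le {s a β ν : ℝ} (hs : 0 < s) (ha : 0 < a) (hν0 : 0 ≤ ν) (hν3 : ν ≤ 3) :
    ((s ^ β + a) ^ 3)⁻¹ ≤ a ^ (-ν) * s ^ (-(β * (3 - ν))) := by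
  have hsb : 0 < s ^ β := Real.rpow_pos_of_pos hs β
  have h := rpow_mul_rpow_le_add_pow_three hsb ha hν0 hν3
  rw [Real.rpow_neg ha.le, Real.rpow_neg hs.le, Real.rpow_mul hs.le, ← mul_inv]
  exact inv_anti₀ (by positivity) h

/-! ### The mass increments of Kato's density -/

/-- **`|ρ(σ,A) - ρ(σ,B)| ≤ (c_D/(1-ν)) σ^{β(ν-2)} B^{1-ν}`** for `0 < A ≤ B`, `σ > 0`, `ν ∈ [0,1)`: the
Fundamental Theorem of Calculus in the mass, (10.9) `|∂_aρ| ≲ σ^β/(σ^β+a)³`, and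
`(σ^β+a)^{-3} ≤ a^{-ν}σ^{-β(3-ν)}` ("By (10.40) and the Fundamental Theorem of Calculus, …
By (10.9) and (10.39)"). [cite: Slade2017, Lemma 10.3.2 (proof, first two displays)] -/
theorem abs_katoDensity_sub_le_low {β : ℝ} (hβ0 : 0 < β) (hβ1 : β < 1) {ν : ℝ} (hν0 : 0 ≤ ν)
    (hν1 : ν < 1) {σ : ℝ} (hσ : 0 < σ) {A B : ℝ} (hA : 0 < A) (hAB : A ≤ B) :
    |Kato.katoDensity β A σ - Kato.katoDensity β B σ| ≤
      8 * Real.sin (π * β) / (π * (1 + Real.cos (π * β)) ^ 2) / (1 - ν) *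
        σ ^ (β * (ν - 2)) * B ^ (1 - ν) := by
  set cD : ℝ := 8 * Real.sin (π * β) / (π * (1 + Real.cos (π * β)) ^ 2) with hcD
  have hsin : 0 < Real.sin (π * β) := Real.sin_pos_of_pos_of_lt_pi (by positivity)
    (by nlinarith [Real.pi_pos])
  have hκ := Kato.one_add_cos_pos hβ0 hβ1
  have hcD0 : 0 < cD := by positivity
  have hB : 0 < B := lt_of_lt_of_le hA hAB
  -- FTC
  have hderiv : ∀ a ∈ Set.uIcc A B, HasDerivAt (fun a => Kato.katoDensity β a σ)
      (Kato.katoDensityDeriv β a σ) a := fun a _ => Kato.hasDerivAt_katoDensity_mass hβ0 hβ1 hσ a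
  have hcont : Continuous fun a => Kato.katoDensityDeriv β a σ := Kato.continuous_katoDensityDeriv_mass hβ0 hβ1 hσ
  have hint : IntervalIntegrable (fun a => Kato.katoDensityDeriv β a σ) volume A B :=
    hcont.intervalIntegrable _ _
  have hftc := intervalIntegral.integral_eq_sub_of_hasDerivAt hderiv hint
  -- the majorant `g(a) = cD σ^{β(ν-2)} a^{-ν}`
  set g : ℝ → ℝ := fun a => cD * σ ^ (β * (ν - 2)) * a ^ (-ν) with hg
  have hgle : ∀ a ∈ Set.Icc A B, |Kato.katoDensityDeriv β a σ| ≤ g a := by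
    intro a ha
    have ha0 : 0 < a := lt_of_lt_of_le hA ha.1
    refine (Kato.abs_katoDensityDeriv_le hβ0 hβ1 ha0.le hσ).trans ?_
    rw [hg, div_eq_mul_inv]
    simp only []
    have h1 := inv_add_pow_three_le (β := β) hσ ha0 hν0 (by linarith)
    have hsb : 0 < σ ^ β := Real.rpow_pos_of_pos hσ β
    calc cD * (σ ^ β * ((σ ^ β + a) ^ 3)⁻¹) ≤ cD * (σ ^ β * (a ^ (-ν) * σ ^ (-(β * (3 - ν))))) := by
          gcongr
      _ = cD * (σ ^ β * σ ^ (-(β * (3 - ν)))) * a ^ (-ν) := by ring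
      _ = cD * σ ^ (β * (ν - 2)) * a ^ (-ν) := by
          rw [← Real.rpow_add hσ]; ring_nf
  have hgint : IntervalIntegrable g volume A B := by
    refine (ContinuousOn.intervalIntegrable ?_)
    rw [Set.uIcc_of_le hAB]
    exact continuousOn_const.mul (ContinuousOn.rpow_const continuousOn_id fun a ha =>
      Or.inl (lt_of_lt_of_le hA ha.1).ne')
  have h1 : |∫ a in A..B, Kato.katoDensityDeriv β a σ| ≤ ∫ a in A..B, g a := by
    refine (intervalIntegral.abs_integral_le_integral_abs hAB).trans ?_
    exact intervalIntegral.integral_mono_on hAB hint.abs hgint fun a ha => hgle a ha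
  have h2 : ∫ a in A..B, g a = cD * σ ^ (β * (ν - 2)) * ((B ^ (-ν + 1) - A ^ (-ν + 1)) / (-ν + 1)) := by
    rw [hg]
    simp only []
    rw [intervalIntegral.integral_const_mul, integral_rpow (Or.inr ⟨by linarith, ?_⟩)]
    rw [Set.uIcc_of_le hAB]
    exact fun h => (lt_irrefl (0 : ℝ)) (lt_of_lt_of_le hA h.1)
  rw [abs_sub_comm, ← hftc]
  refine h1.trans ?_
  rw [h2]
  have hA1 : 0 ≤ A ^ (-ν + 1) := Real.rpow_nonneg hA.le _
  have h1ν : 0 < -ν + 1 := by linarith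
  have hσe : 0 < σ ^ (β * (ν - 2)) := Real.rpow_pos_of_pos hσ _
  rw [show (1 - ν : ℝ) = -ν + 1 by ring]
  have : (B ^ (-ν + 1) - A ^ (-ν + 1)) / (-ν + 1) ≤ B ^ (-ν + 1) / (-ν + 1) :=
    div_le_div_of_nonneg_right (by linarith) h1ν.le
  calc cD * σ ^ (β * (ν - 2)) * ((B ^ (-ν + 1) - A ^ (-ν + 1)) / (-ν + 1))
      ≤ cD * σ ^ (β * (ν - 2)) * (B ^ (-ν + 1) / (-ν + 1)) :=
        mul_le_mul_of_nonneg_left this (by positivity)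
    _ = cD / (-ν + 1) * σ ^ (β * (ν - 2)) * B ^ (-ν + 1) := by ring

/-- **`|ρ(σ,A) - ρ(σ,B)| ≤ (c_D/2) σ^β A^{-2}`** for `0 < A ≤ B`, `σ > 0`: FTC, (10.9) and
`(σ^β+a)^{-3} ≤ a^{-3}`. [cite: Slade2017, Lemma 10.3.2 (proof)] -/
theorem abs_katoDensity_sub_le_high {β : ℝ} (hβ0 : 0 < β) (hβ1 : β < 1) {σ : ℝ} (hσ : 0 < σ)
    {A B : ℝ} (hA : 0 < A) (hAB : A ≤ B) :
    |Kato.katoDensity β A σ - Kato.katoDensity β B σ| ≤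
      8 * Real.sin (π * β) / (π * (1 + Real.cos (π * β)) ^ 2) / 2 * σ ^ β * (A ^ 2)⁻¹ := by
  set cD : ℝ := 8 * Real.sin (π * β) / (π * (1 + Real.cos (π * β)) ^ 2) with hcD
  have hsin : 0 < Real.sin (π * β) := Real.sin_pos_of_pos_of_lt_pi (by positivity)
    (by nlinarith [Real.pi_pos])
  have hκ := Kato.one_add_cos_pos hβ0 hβ1
  have hcD0 : 0 < cD := by positivity
  have hB : 0 < B := lt_of_lt_of_le hA hAB
  have hderiv : ∀ a ∈ Set.uIcc A B, HasDerivAt (fun a => Kato.katoDensity β a σ)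
      (Kato.katoDensityDeriv β a σ) a := fun a _ => Kato.hasDerivAt_katoDensity_mass hβ0 hβ1 hσ a
  have hcont : Continuous fun a => Kato.katoDensityDeriv β a σ := Kato.continuous_katoDensityDeriv_mass hβ0 hβ1 hσ
  have hint : IntervalIntegrable (fun a => Kato.katoDensityDeriv β a σ) volume A B :=
    hcont.intervalIntegrable _ _
  have hftc := intervalIntegral.integral_eq_sub_of_hasDerivAt hderiv hint
  set g : ℝ → ℝ := fun a => cD * σ ^ β * a ^ (-(3 : ℝ)) with hg
  have hsb : 0 < σ ^ β := Real.rpow_pos_of_pos hσ β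
  have hgle : ∀ a ∈ Set.Icc A B, |Kato.katoDensityDeriv β a σ| ≤ g a := by
    intro a ha
    have ha0 : 0 < a := lt_of_lt_of_le hA ha.1
    refine (Kato.abs_katoDensityDeriv_le hβ0 hβ1 ha0.le hσ).trans ?_
    rw [hg]
    simp only []
    have h1 : ((σ ^ β + a) ^ 3)⁻¹ ≤ a ^ (-(3 : ℝ)) := by
      rw [Real.rpow_neg ha0.le, (by norm_num : (3 : ℝ) = ((3 : ℕ) : ℝ)), Real.rpow_natCast]
      apply inv_anti₀ (by positivity)
      apply pow_le_pow_left₀ ha0.le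
      linarith
    rw [div_eq_mul_inv]
    calc cD * (σ ^ β * ((σ ^ β + a) ^ 3)⁻¹) ≤ cD * (σ ^ β * a ^ (-(3 : ℝ))) := by gcongr
      _ = _ := by ring
  have hgint : IntervalIntegrable g volume A B := by
    refine (ContinuousOn.intervalIntegrable ?_)
    rw [Set.uIcc_of_le hAB]
    exact continuousOn_const.mul (ContinuousOn.rpow_const continuousOn_id fun a ha =>
      Or.inl (lt_of_lt_of_le hA ha.1).ne')
  have h1 : |∫ a in A..B, Kato.katoDensityDeriv β a σ| ≤ ∫ a in A..B, g a := by
    refine (intervalIntegral.abs_integral_le_integral_abs hAB).trans ?_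
    exact intervalIntegral.integral_mono_on hAB hint.abs hgint fun a ha => hgle a ha
  have h2 : ∫ a in A..B, g a = cD * σ ^ β * ((B ^ (-(3 : ℝ) + 1) - A ^ (-(3 : ℝ) + 1)) / (-(3 : ℝ) + 1)) := by
    rw [hg]
    simp only []
    rw [intervalIntegral.integral_const_mul, integral_rpow (Or.inr ⟨by norm_num, ?_⟩)]
    rw [Set.uIcc_of_le hAB]
    exact fun h => (lt_irrefl (0 : ℝ)) (lt_of_lt_of_le hA h.1)
  rw [abs_sub_comm, ← hftc]
  refine h1.trans ?_
  rw [h2, show (-(3 : ℝ) + 1) = -2 by norm_num]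
  have hB2 : 0 ≤ B ^ (-(2 : ℝ)) := Real.rpow_nonneg hB.le _
  have hA2 : A ^ (-(2 : ℝ)) = (A ^ 2)⁻¹ := by rw [Real.rpow_neg hA.le, Real.rpow_two]
  have : (B ^ (-(2 : ℝ)) - A ^ (-(2 : ℝ))) / (-2) ≤ (A ^ 2)⁻¹ / 2 := by
    rw [← hA2]
    have : (B ^ (-(2 : ℝ)) - A ^ (-(2 : ℝ))) / (-2) = (A ^ (-(2 : ℝ)) - B ^ (-(2 : ℝ))) / 2 := by ring
    rw [this]
    linarith
  calc cD * σ ^ β * ((B ^ (-(2 : ℝ)) - A ^ (-(2 : ℝ))) / (-2)) ≤ cD * σ ^ β * ((A ^ 2)⁻¹ / 2) :=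
        mul_le_mul_of_nonneg_left this (by positivity)
    _ = cD / 2 * σ ^ β * (A ^ 2)⁻¹ := by ring

/-! ### The `σ`-integrals `∫|G_L(y,σ)|σ^e dσ` -/

/-- For `K, b > 0` and `-1 < e < 1`: `σ ↦ K(1+bσ)^{-2}σ^e` is integrable on `(0,∞)` and
`∫_0^∞ K(1+bσ)^{-2}σ^e dσ ≤ K(1/(e+1) + b^{-2}/(1-e))` (split at `σ = 1`).
[cite: Slade2017, Lemma 10.3.2 (proof: "We decompose the σ-integral as ∫_0^∞ = ∫_0^1 + ∫_1^∞")] -/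
theorem integral_majorant_rpow_le {K b e : ℝ} (hK : 0 ≤ K) (hb : 0 < b) (he1 : -1 < e) (he2 : e < 1) :
    IntegrableOn (fun σ : ℝ => K * ((1 + b * σ) ^ 2)⁻¹ * σ ^ e) (Ioi 0) ∧
    ∫ σ in Ioi 0, K * ((1 + b * σ) ^ 2)⁻¹ * σ ^ e ≤ K * (1 / (e + 1) + (b ^ 2)⁻¹ / (1 - e)) := by
  have hmeas : Measurable fun σ : ℝ => K * ((1 + b * σ) ^ 2)⁻¹ * σ ^ e :=
    (measurable_const.mul ((measurable_const.add (measurable_const.mul measurable_id)).pow_const 2).inv).mul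
      (measurable_id.pow_const _)
  have hnn : ∀ σ : ℝ, 0 < σ → 0 ≤ K * ((1 + b * σ) ^ 2)⁻¹ * σ ^ e := fun σ hσ => by
    have := Real.rpow_nonneg hσ.le e; positivity
  -- `(0,1]`: `≤ K σ^e`
  have hle1 : ∀ σ ∈ Ioc (0 : ℝ) 1, K * ((1 + b * σ) ^ 2)⁻¹ * σ ^ e ≤ K * σ ^ e := by
    intro σ hσ
    have h1 : ((1 + b * σ) ^ 2)⁻¹ ≤ 1 :=
      inv_le_one_of_one_le₀ (one_le_pow₀ (by nlinarith [mul_pos hb hσ.1]))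
    have := Real.rpow_nonneg hσ.1.le e
    calc K * ((1 + b * σ) ^ 2)⁻¹ * σ ^ e ≤ K * 1 * σ ^ e := by gcongr
      _ = K * σ ^ e := by ring
  have hi1 : IntegrableOn (fun σ : ℝ => K * σ ^ e) (Ioc (0 : ℝ) 1) :=
    (CovBound.integrableOn_rpow_Ioc_zero he1 zero_le_one).const_mul K
  have h01 : IntegrableOn (fun σ : ℝ => K * ((1 + b * σ) ^ 2)⁻¹ * σ ^ e) (Ioc (0 : ℝ) 1) :=
    Integrable.mono' hi1 hmeas.aestronglyMeasurable ((ae_restrict_iff' measurableSet_Ioc).2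
      (Eventually.of_forall fun σ hσ => by
        rw [Real.norm_eq_abs, abs_of_nonneg (hnn σ hσ.1)]; exact hle1 σ hσ))
  -- `(1,∞)`: `≤ K b^{-2} σ^{e-2}`
  have hr : e - 2 < -1 := by linarith
  have hle2 : ∀ σ ∈ Ioi (1 : ℝ), K * ((1 + b * σ) ^ 2)⁻¹ * σ ^ e ≤ K * (b ^ 2)⁻¹ * σ ^ (e - 2) := by
    intro σ hσ
    have hσ1 : (1 : ℝ) < σ := hσ
    have hσ0 : 0 < σ := by linarith
    have h1 : ((1 + b * σ) ^ 2)⁻¹ ≤ (b ^ 2)⁻¹ * σ ^ (-2 : ℝ) := by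
      rw [Real.rpow_neg hσ0.le, Real.rpow_two, ← mul_inv, ← mul_pow]
      apply inv_anti₀ (by positivity)
      apply pow_le_pow_left₀ (by positivity)
      linarith
    have := Real.rpow_nonneg hσ0.le e
    calc K * ((1 + b * σ) ^ 2)⁻¹ * σ ^ e ≤ K * ((b ^ 2)⁻¹ * σ ^ (-2 : ℝ)) * σ ^ e := by gcongr
      _ = K * (b ^ 2)⁻¹ * (σ ^ (-2 : ℝ) * σ ^ e) := by ring
      _ = K * (b ^ 2)⁻¹ * σ ^ (e - 2) := by rw [← Real.rpow_add hσ0]; ring_nf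
  have hi2 : IntegrableOn (fun σ : ℝ => K * (b ^ 2)⁻¹ * σ ^ (e - 2)) (Ioi (1 : ℝ)) :=
    (integrableOn_Ioi_rpow_of_lt hr zero_lt_one).const_mul _
  have h1i : IntegrableOn (fun σ : ℝ => K * ((1 + b * σ) ^ 2)⁻¹ * σ ^ e) (Ioi (1 : ℝ)) :=
    Integrable.mono' hi2 hmeas.aestronglyMeasurable ((ae_restrict_iff' measurableSet_Ioi).2
      (Eventually.of_forall fun σ hσ => by
        rw [Real.norm_eq_abs, abs_of_nonneg (hnn σ (lt_trans zero_lt_one hσ))]; exact hle2 σ hσ))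
  have hu : IntegrableOn (fun σ : ℝ => K * ((1 + b * σ) ^ 2)⁻¹ * σ ^ e) (Ioi 0) := by
    have := h01.union h1i
    rwa [Ioc_union_Ioi_eq_Ioi zero_le_one] at this
  refine ⟨hu, ?_⟩
  have hdj : Disjoint (Ioc (0 : ℝ) 1) (Ioi 1) := Set.disjoint_left.2 fun s hs hs' => not_lt.2 hs.2 hs'
  rw [← Ioc_union_Ioi_eq_Ioi zero_le_one, setIntegral_union hdj measurableSet_Ioi h01 h1i]
  have hp1 : ∫ σ in Ioc (0 : ℝ) 1, K * ((1 + b * σ) ^ 2)⁻¹ * σ ^ e ≤ K * (1 / (e + 1)) := by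
    calc ∫ σ in Ioc (0 : ℝ) 1, K * ((1 + b * σ) ^ 2)⁻¹ * σ ^ e ≤ ∫ σ in Ioc (0 : ℝ) 1, K * σ ^ e :=
          setIntegral_mono_on h01 hi1 measurableSet_Ioc hle1
      _ = K * (1 / (e + 1)) := by
          rw [integral_const_mul, CovBound.setIntegral_rpow_Ioc_zero he1 zero_le_one, Real.one_rpow]
  have hp2 : ∫ σ in Ioi (1 : ℝ), K * ((1 + b * σ) ^ 2)⁻¹ * σ ^ e ≤ K * ((b ^ 2)⁻¹ / (1 - e)) := by
    calc ∫ σ in Ioi (1 : ℝ), K * ((1 + b * σ) ^ 2)⁻¹ * σ ^ e ≤ ∫ σ in Ioi (1 : ℝ), K * (b ^ 2)⁻¹ * σ ^ (e - 2) :=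
          setIntegral_mono_on h1i hi2 measurableSet_Ioi hle2
      _ = K * ((b ^ 2)⁻¹ / (1 - e)) := by
          rw [integral_const_mul, integral_Ioi_rpow_of_lt hr zero_lt_one, Real.one_rpow]
          rw [show (e - 2 + 1 : ℝ) = -(1 - e) by ring]
          have : (1 - e : ℝ) ≠ 0 := by linarith
          field_simp
  calc (∫ σ in Ioc (0 : ℝ) 1, K * ((1 + b * σ) ^ 2)⁻¹ * σ ^ e) +
        ∫ σ in Ioi (1 : ℝ), K * ((1 + b * σ) ^ 2)⁻¹ * σ ^ e
      ≤ K * (1 / (e + 1)) + K * ((b ^ 2)⁻¹ / (1 - e)) := add_le_add hp1 hp2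
    _ = _ := by ring

/-! ### Lemma 10.3.2 -/

/-- The two-sided mass increment of `c₀` against a weight: if `|ρ(σ,A) - ρ(σ,B)| ≤ M σ^e` for all
`σ > 0` with `-1 < e < 1`, then `|c₀(y,A) - c₀(y,B)| ≤ M K (1/(e+1) + b^{-2}/(1-e))`, `b = 1/(8dL²)`,
`K` the constant of `abs_cZeroKer_le` (`p = 2`). [cite: Slade2017, Lemma 10.3.2 (proof, the σ-integration)] -/
theorem abs_cZero_sub_le_of {d : ℕ} (hd : 1 ≤ d) {L : ℝ} (hL : 1 ≤ L) {β : ℝ} (hβ0 : 0 < β) (hβ1 : β < 1)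
    {K : ℝ} (hK : 0 < K) (hG : ∀ σ : ℝ, 0 ≤ σ → ∀ y : Fin d → ℝ,
      |cZeroKer d L y σ| ≤ K * ((1 + σ / (8 * d * L ^ 2)) ^ 2)⁻¹)
    {e : ℝ} (he1 : -1 < e) (he2 : e < 1) {M : ℝ} (hM : 0 ≤ M) {A B : ℝ}
    (hρ : ∀ σ : ℝ, 0 < σ → |Kato.katoDensity β A σ - Kato.katoDensity β B σ| ≤ M * σ ^ e)
    (y : Fin d → ℝ) :
    |cZero d L (2 * β) y A - cZero d L (2 * β) y B| ≤
      M * (K * (1 / (e + 1) + ((1 / (8 * d * L ^ 2)) ^ 2)⁻¹ / (1 - e))) := by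
  have hd' : (1 : ℝ) ≤ d := by exact_mod_cast hd
  have hb : (0 : ℝ) < 1 / (8 * d * L ^ 2) := by positivity
  have hβ' : 2 * β / 2 = β := by ring
  have hiA := integrableOn_cZeroKer_mul_katoDensity hd hL hβ0 hβ1 A y
  have hiB := integrableOn_cZeroKer_mul_katoDensity hd hL hβ0 hβ1 B y
  unfold cZero
  rw [hβ', ← integral_sub hiA hiB]
  obtain ⟨hmi, hmle⟩ := integral_majorant_rpow_le (K := M * K) (by positivity) hb he1 he2
  have hle : ∀ᵐ σ ∂((volume : Measure ℝ).restrict (Ioi 0)),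
      ‖cZeroKer d L y σ * Kato.katoDensity β A σ - cZeroKer d L y σ * Kato.katoDensity β B σ‖ ≤
        M * K * ((1 + 1 / (8 * d * L ^ 2) * σ) ^ 2)⁻¹ * σ ^ e := by
    refine (ae_restrict_iff' measurableSet_Ioi).2 (Eventually.of_forall fun σ hσ => ?_)
    have hσ0 : (0 : ℝ) < σ := hσ
    rw [Real.norm_eq_abs, ← mul_sub, abs_mul]
    have h1 := hG σ hσ0.le y
    have e1 : σ / (8 * d * L ^ 2) = 1 / (8 * d * L ^ 2) * σ := by ring
    rw [e1] at h1
    have h2 := hρ σ hσ0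
    calc |cZeroKer d L y σ| * |Kato.katoDensity β A σ - Kato.katoDensity β B σ|
        ≤ K * ((1 + 1 / (8 * d * L ^ 2) * σ) ^ 2)⁻¹ * (M * σ ^ e) :=
          mul_le_mul h1 h2 (abs_nonneg _) (by positivity)
      _ = _ := by ring
  have h := norm_integral_le_of_norm_le hmi hle
  rw [Real.norm_eq_abs] at h
  refine h.trans (hmle.trans (le_of_eq ?_))
  ring

/-- **Slade, Lemma 10.3.2, PROVED**: "Let `d ≥ 1`, `α ∈ (0,2∧d)`. There exists `z > 0` such that
for `x ∈ ℝ^d` and `0 < A < A'`, (10.42) `|c₀(x,A) - c₀(x,A')| ≲ 𝟙_{A≤1}(A')^z + 𝟙_{A'>1}A^{-2}`." Here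
for `c₀ = FRD.cZero d L α` (any `L ≥ 1`), with `z = (1 - max(0, 2-2/α))/2 ∈ (0,1)` and an explicit
constant depending on `d, α, L` only. Printed proof, followed: "`c₀(x,A) - c₀(x,A') =
∫_0^∞dσ∫_A^{A'}da (∂ρ(σ,a)/∂a)∫(dτ/τ)(c/τ)^{d-2}w̄(cx/τ, στ²)`. By (10.9) and (10.39), with arbitrary
`p ≥ 0` and with `β = α/2`, `|c₀(x,A) - c₀(x,A')| ≲ ∫_A^{A'}da∫_0^∞dσ (σ^β/(σ^β+a)³)∫(dτ/τ)τ^{2-d}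
(1+στ²)^{-p}`. We decompose the `σ`-integral as `∫_0^∞ = ∫_0^1 + ∫_1^∞` … bounded by a multiple of
`(𝟙_{a≤1}a^{-(2-1/β)} + 𝟙_{a≥1}a^{-3}) + (𝟙_{a≤1} + 𝟙_{a≥1}a^{-p'})` … Integration of this upper bound
then gives the desired result, with `z = -1+1/β > 0`." (Here the `a`-integral is evaluated first,
through `(σ^β+a)^{-3} ≤ a^{-ν}σ^{-β(3-ν)}` with `ν = (1 + max(0,2-1/β))/2` on `a ≤ 1` and
`(σ^β+a)^{-3} ≤ a^{-3}` on `a ≥ 1`, which gives `z = 1 - ν` for every `β ∈ (0,1)` at once, including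
the logarithmic case `β = ½`.) [cite: Slade2017, Lemma 10.3.2 (display (10.42)) and its proof, §10.3] -/
theorem Slade2017_lem1032 {d : ℕ} (hd : 1 ≤ d) {α : ℝ} (hα0 : 0 < α) (hα2 : α < 2) {L : ℝ} (hL : 1 ≤ L) :
    ∃ z : ℝ, 0 < z ∧ ∃ C : ℝ, 0 < C ∧ ∀ y : Fin d → ℝ, ∀ A A' : ℝ, 0 < A → A < A' →
      |cZero d L α y A - cZero d L α y A'| ≤
        C * ((if A ≤ 1 then A' ^ z else 0) + (if 1 < A' then (A ^ 2)⁻¹ else 0)) := by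
  have hd' : (1 : ℝ) ≤ d := by exact_mod_cast hd
  set β : ℝ := α / 2 with hβ
  have hβ0 : 0 < β := by positivity
  have hβ1 : β < 1 := by rw [hβ]; linarith
  have hαβ : α = 2 * β := by rw [hβ]; ring
  -- the exponent `ν ∈ [max(0,2-1/β), 1)`
  set ν : ℝ := (1 + max 0 (2 - 1 / β)) / 2 with hν
  have hmax1 : max 0 (2 - 1 / β) < 1 := by
    refine max_lt (by norm_num) ?_
    have : 1 < 1 / β := by rw [lt_div_iff₀ hβ0]; linarith
    linarith
  have hmax0 : 0 ≤ max 0 (2 - 1 / β) := le_max_left _ _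
  have hν0 : 0 ≤ ν := by rw [hν]; linarith
  have hν1 : ν < 1 := by rw [hν]; linarith
  have hνβ : -1 < β * (ν - 2) := by
    -- `ν > 2 - 1/β`
    have h1 : 2 - 1 / β < ν := by
      have := le_max_right 0 (2 - 1 / β)
      rw [hν]; linarith
    have h2 : β * (2 - 1 / β) = 2 * β - 1 := by field_simp
    nlinarith [mul_lt_mul_of_pos_left h1 hβ0]
  have hνβ' : β * (ν - 2) < 1 := by nlinarith
  obtain ⟨K, hK, hG⟩ := abs_cZeroKer_le hd hL 2
  have hG' : ∀ σ : ℝ, 0 ≤ σ → ∀ y : Fin d → ℝ, |cZeroKer d L y σ| ≤ K * ((1 + σ / (8 * d * L ^ 2)) ^ 2)⁻¹ :=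
    fun σ hσ y => (hG σ hσ y).2
  set cD : ℝ := 8 * Real.sin (π * β) / (π * (1 + Real.cos (π * β)) ^ 2) with hcD
  have hsin : 0 < Real.sin (π * β) := Real.sin_pos_of_pos_of_lt_pi (by positivity)
    (by nlinarith [Real.pi_pos])
  have hκ := Kato.one_add_cos_pos hβ0 hβ1
  have hcD0 : 0 < cD := by positivity
  set b : ℝ := 1 / (8 * d * L ^ 2) with hb
  have hb0 : 0 < b := by positivity
  set Jlow : ℝ := K * (1 / (β * (ν - 2) + 1) + (b ^ 2)⁻¹ / (1 - β * (ν - 2))) with hJlow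
  set Jhigh : ℝ := K * (1 / (β + 1) + (b ^ 2)⁻¹ / (1 - β)) with hJhigh
  have hJlow0 : 0 < Jlow := by
    have : 0 < β * (ν - 2) + 1 := by linarith
    have : 0 < 1 - β * (ν - 2) := by linarith
    positivity
  have hJhigh0 : 0 < Jhigh := by
    have : 0 < 1 - β := by linarith
    positivity
  refine ⟨1 - ν, by linarith, cD / (1 - ν) * Jlow + cD / 2 * Jhigh, by
    have : 0 < 1 - ν := by linarith
    positivity, fun y A A' hA hAA' => ?_⟩
  have hA' : 0 < A' := by linarith
  -- the intermediate mass `m = max A (min 1 A')`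
  set m : ℝ := max A (min 1 A') with hm
  have hAm : A ≤ m := le_max_left _ _
  have hmA' : m ≤ A' := max_le hAA'.le (min_le_right _ _)
  have hm0 : 0 < m := lt_of_lt_of_le hA hAm
  -- low part: `|c₀(A) - c₀(m)| ≤ (cD/(1-ν)) Jlow m^{1-ν}`, and it vanishes unless `A ≤ 1`
  have hlow : |cZero d L α y A - cZero d L α y m| ≤
      cD / (1 - ν) * Jlow * (if A ≤ 1 then A' ^ (1 - ν) else 0) := by
    split_ifs with hA1
    · have hρ : ∀ σ : ℝ, 0 < σ → |Kato.katoDensity β A σ - Kato.katoDensity β m σ| ≤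
          cD / (1 - ν) * m ^ (1 - ν) * σ ^ (β * (ν - 2)) := by
        intro σ hσ
        have h := abs_katoDensity_sub_le_low hβ0 hβ1 hν0 hν1 hσ hA hAm
        rw [← hcD] at h
        refine h.trans (le_of_eq ?_)
        ring
      have h := abs_cZero_sub_le_of hd hL hβ0 hβ1 hK hG' hνβ hνβ' (by positivity) hρ y
      rw [← hαβ] at h
      refine h.trans ?_
      rw [← hb, ← hJlow]
      -- `m ≤ min 1 A' ≤ A'` and `m ≤ 1`, so `m^{1-ν} ≤ A'^{1-ν}`
      have hm_le : m ≤ A' := hmA'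
      have h1 : m ^ (1 - ν) ≤ A' ^ (1 - ν) := Real.rpow_le_rpow hm0.le hm_le (by linarith)
      have : cD / (1 - ν) * m ^ (1 - ν) * Jlow ≤ cD / (1 - ν) * A' ^ (1 - ν) * Jlow := by
        have : 0 < 1 - ν := by linarith
        gcongr
      linarith [this]
    · -- `A > 1`: `min 1 A' = 1 ≤ A`, so `m = A`
      have hA1' : 1 < A := lt_of_not_ge hA1
      have hmA : m = A := by
        rw [hm, max_eq_left]
        exact le_trans (min_le_left _ _) hA1'.le
      rw [hmA, sub_self, abs_zero, mul_zero]
  -- high part: `|c₀(m) - c₀(A')| ≤ (cD/2) Jhigh m^{-2}`, and it vanishes unless `A' > 1`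
  have hhigh : |cZero d L α y m - cZero d L α y A'| ≤
      cD / 2 * Jhigh * (if 1 < A' then (A ^ 2)⁻¹ else 0) := by
    split_ifs with hA1
    · have hρ : ∀ σ : ℝ, 0 < σ → |Kato.katoDensity β m σ - Kato.katoDensity β A' σ| ≤
          cD / 2 * (m ^ 2)⁻¹ * σ ^ β := by
        intro σ hσ
        have h := abs_katoDensity_sub_le_high hβ0 hβ1 hσ hm0 hmA'
        rw [← hcD] at h
        refine h.trans (le_of_eq ?_)
        ring
      have h := abs_cZero_sub_le_of hd hL hβ0 hβ1 hK hG' (by linarith : (-1 : ℝ) < β) hβ1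
        (by positivity) hρ y
      rw [← hαβ] at h
      refine h.trans ?_
      rw [← hb, ← hJhigh]
      have h1 : (m ^ 2)⁻¹ ≤ (A ^ 2)⁻¹ := by
        apply inv_anti₀ (by positivity)
        exact pow_le_pow_left₀ hA.le hAm 2
      have : cD / 2 * (m ^ 2)⁻¹ * Jhigh ≤ cD / 2 * (A ^ 2)⁻¹ * Jhigh := by gcongr
      linarith [this]
    · -- `A' ≤ 1`: `m = A'`
      have hA1' : A' ≤ 1 := le_of_not_gt hA1
      have hmA : m = A' := by
        rw [hm, min_eq_right hA1', max_eq_right hAA'.le]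
      rw [hmA, sub_self, abs_zero, mul_zero]
  calc |cZero d L α y A - cZero d L α y A'|
      ≤ |cZero d L α y A - cZero d L α y m| + |cZero d L α y m - cZero d L α y A'| := abs_sub_le _ _ _
    _ ≤ cD / (1 - ν) * Jlow * (if A ≤ 1 then A' ^ (1 - ν) else 0) +
          cD / 2 * Jhigh * (if 1 < A' then (A ^ 2)⁻¹ else 0) := add_le_add hlow hhigh
    _ ≤ (cD / (1 - ν) * Jlow + cD / 2 * Jhigh) * ((if A ≤ 1 then A' ^ (1 - ν) else 0) +
          (if 1 < A' then (A ^ 2)⁻¹ else 0)) := by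
        have h1 : 0 ≤ (if A ≤ 1 then A' ^ (1 - ν) else 0 : ℝ) := by
          split_ifs
          · exact Real.rpow_nonneg hA'.le _
          · exact le_rfl
        have h2 : 0 ≤ (if 1 < A' then (A ^ 2)⁻¹ else 0 : ℝ) := by
          split_ifs
          · positivity
          · exact le_rfl
        have h3 : 0 ≤ cD / (1 - ν) * Jlow := by
          have : 0 < 1 - ν := by linarith
          positivity
        have h4 : 0 ≤ cD / 2 * Jhigh := by positivity
        nlinarith [mul_nonneg h3 h2, mul_nonneg h4 h1]

end FRD

end LongRangePhi4

end Literature.Barriers.CriticalPhenomena
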